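import Mathlib
import HarnessLib
import Summits.CriticalPhenomena.CardyFormulaZ2.Theses.CardySelfRefinement
import Summits.CriticalPhenomena.CardyFormulaZ2.Theorems.CardySelfRefinementSymmetryUpgradeRExitModulus
import Summits.CriticalPhenomena.CardyFormulaZ2.Theorems.CardyAnchoredRigidityStretchedPullbackNotTargetBlindHitsBefore
import Literature.Probability.Percolation.SmirnovContinuumLimit
import Literature.Probability.RandomPlanarGeometry.ChordalReversibility
import Literature.Probability.RandomPlanarGeometry.ConformalRectangle
import Literature.Probability.RandomPlanarGeometry.IsometryCovariance
import Literature.Probability.RandomPlanarGeometry.PlanarDomainsTopology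
import Literature.Probability.RandomPlanarGeometry.RadoContinuity

/-!
# Crux `SymmetryUpgradeR` (stmt-CriticalPhenomena-17239), line `SketchIdeatorTwo` — helper
# `exitRigidity_targetTransfer` for stub `stub_exitRigidity` (FL4, "the pin"): the dent rung

Second rung of the reduction "S4 = a statement about ONE real function `F_P`" of idea card
`swallowing-skeleton-rs-pin`: **the target-independence transfer linking boundary touching to the
exit function**, and the resulting **domination of the exit function by the touch envelope**.

* `exitRigidity_targetTransfer` — for a target independent family `P`
  (`ChordalFamily.IsTargetIndependent`, LSW 2001 Cor. 2.3 = Werner 2007 Prop. 3.4) and every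
  conformal rectangle `R = (Ω; a, b, c, d)`, the probability that the curve from `a` to `b` in
  `(Ω; a, b)` hits the far arc `(cd)` before `(bc)` EQUALS the exit probability
  `h_P(R) = P_{(Ω; a, c)}((cd) before (bc))` of the rectangle: the crossing event
  `hitsBefore (cd) (bc)` is an event of the curve stopped on the arc `(bc) = [b, c]` of the
  three-marked domain `(Ω; a, b, c)` (`MarkedDomain.forgetLast R`), on which target independence
  identifies the laws towards `b` and towards `c`.
* `hitsBefore_subset_touch` — if `(cd) ⊆ B(z, ε)` then `hitsBefore (cd) (bc) ⊆ {γ meets B(z, ε)}`.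
* `exitRigidity_exitFunction_le_touch` — hence, for a chordal, conformally covariant (so that
  `P (Ω; a, b)` does not depend on the boundary parametrisation), target independent family, every
  rectangle `R` on the Dobrushin domain `D = (Ω; a, b)` (same carrier, first two marked points
  `a, b`) whose third arc lies in `B(z, ε)` has `h_P(R) ≤ P_D(γ meets B(z, ε))`.
* `exists_dentRectangle` — the rectangles `(Ω; a, b, ∂Ω(s₂), ∂Ω(s₃))` for parameters
  `mark 1 < s₂ < s₃ < mark 0 + 1` on the free arc exist as `ConformalRectangle`s (the boundary loop
  re-based at `a`), with all marked points and arcs identified; `exists_dentRectangle_subset_ball`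
  — around every interior point `z` of the free arc and every `ε > 0` there is one with
  `z ∈ (cd) ⊆ B(z, ε)`.
* `exitRigidity_touchEnvelope` — the assembled DENT INEQUALITY: for every interior point `z` of the
  free arc of `D` and every `ε > 0` there is a non-degenerate conformal rectangle `R_ε` on `D` with
  third arc through `z` inside `B(z, ε)` and `h_P(R_ε) ≤ P_D(γ meets B(z, ε))`; with the exit
  function (`exitRigidity_exitFunctionOfModulus_isometry`, landed) this reads
  `F_P(η(R_ε)) ≤ P_D(U_ε(z))` (`exitRigidity_exitFunctionOfModulus_le_touch`): the touch upper
  envelope `C ε^{1/3}` of stub `stub_exitRigidity` bounds the exit function along the dent moduli.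

No new mathematics; the converse domination (touch event inside a union of dent events, which needs
`IsLocal` and one Markov renewal at a boundary-arc landing) and the cross-ratio asymptotics
`η(R_ε) ≍ ε` at a flat wall are not in this file.

## References

* G. Lawler, O. Schramm, W. Werner, *Values of Brownian intersection exponents I*, Acta Math. 187
  (2001), Cor. 2.3 (splitting form of locality).
* W. Werner, *Lectures on two-dimensional critical percolation*, IAS/Park City (2007), Prop. 3.4.
* M. Aizenman, A. Burchard, Duke Math. J. 99 (1999), §2.1 (curve space, crossing events).
-/

noncomputable section

namespace Summit.CriticalPhenomena.CardyFormulaZ2.Theorems.SymmetryUpgradeR.SwallowingSkeleton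

open MeasureTheory Filter Set Metric
open Literature.Probability.RandomPlanarGeometry Literature.Probability.LatticeModels
  Literature.Probability.Percolation
open UpperHalfPlane (upperHalfPlaneSet)

/-! ### Target-independence transfer -/

/-- Registered helper `exitRigidity_targetTransfer` (for stub `stub_exitRigidity`, line
`SketchIdeatorTwo` of crux stmt-CriticalPhenomena-17239). **Target-independence transfer.** For a
target independent family and a conformal rectangle `R = (Ω; a, b, c, d)`, the law towards `b`
and the law towards `c` give the same probability to the crossing event "`(cd)` before `(bc)`":
`P_{(Ω; a, b)}((cd) before (bc)) = P_{(Ω; a, c)}((cd) before (bc)) = h_P(R)`. Proof: in the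
three-marked domain `(Ω; a, b, c) = forgetLast R` the stopping arc is `[b, c] = R.arc 1`, and
`hitsBefore (R.arc 2) (R.arc 1)` is an event of the curve stopped on `R.arc 1`
(`CurveClass.stopAt_preimage_hitsBefore` with `B = F = R.arc 1`), so `IsTargetIndependent`
applies verbatim (LSW 2001 Cor. 2.3; Werner 2007 Prop. 3.4). -/
theorem exitRigidity_targetTransfer : ∀ P : ChordalFamily, P.IsTargetIndependent → ∀ R : ConformalRectangle, P (R.chord 0 1 (by decide)) (CurveClass.hitsBefore (R.arc 2) (R.arc 1)) = P (R.chord 0 2 (by decide)) (CurveClass.hitsBefore (R.arc 2) (R.arc 1)) := by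
  intro P hTI R
  have hB : IsClosed (R.arc 1) := R.isClosed_arc 1
  have key := hTI (MarkedDomain.forgetLast R) _
    (CurveClass.measurableSet_hitsBefore_holds (R.isClosed_arc 2) hB)
  rwa [MarkedDomain.forgetLast_arc_one,
    StretchedPullback.CurveClass.stopAt_preimage_hitsBefore hB hB Subset.rfl subset_union_right]
    at key

/-- Real-valued form of `exitRigidity_targetTransfer`. -/
theorem exitRigidity_targetTransfer_real (P : ChordalFamily) (hTI : P.IsTargetIndependent)
    (R : ConformalRectangle) :
    (P (R.chord 0 1 (by decide))).real (CurveClass.hitsBefore (R.arc 2) (R.arc 1)) =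
      (P (R.chord 0 2 (by decide))).real (CurveClass.hitsBefore (R.arc 2) (R.arc 1)) := by
  rw [measureReal_def, exitRigidity_targetTransfer P hTI R, measureReal_def]

/-! ### Monotone comparison with the touch event -/

/-- **A crossing of a set inside `B(z, ε)` touches `B(z, ε)`**: if `A ⊆ B(z, ε)` then
`hitsBefore A B ⊆ {γ | ∃ w ∈ range γ, dist w z < ε}` (the witnessing representative visits `A`). -/
theorem hitsBefore_subset_touch {A B : Set ℂ} {z : ℂ} {ε : ℝ} (hA : A ⊆ ball z ε) :
    CurveClass.hitsBefore A B ⊆ {γ | ∃ w ∈ γ.range, dist w z < ε} := by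
  rintro _ ⟨g, ⟨t, htA, -⟩, rfl⟩
  exact ⟨g t, by rw [CurveClass.range_mk]; exact ⟨t, rfl⟩, mem_ball.1 (hA htA)⟩

/-- Push-forward along the identity of the plane is the identity on curve classes. -/
theorem curveClassMap_id : CurveClass.map (ContinuousMap.id ℂ) = id := by
  funext c
  obtain ⟨g, rfl⟩ := CurveClass.surjective_mk c
  rw [CurveClass.map_mk, id]
  congr 1

/-- **A conformally covariant family depends on a Dobrushin domain only through its carrier and
its two marked points** (not through the boundary parametrisation): take the identity as the
conformal equivalence in `IsConformallyCovariant` (`eq_map_of_image` with `Φ = id`). -/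
theorem eq_of_carrier_eq_of_isConformallyCovariant {P : ChordalFamily}
    (hcov : P.IsConformallyCovariant) {D₁ D₂ : DobrushinDomain} (hc : D₁.carrier = D₂.carrier)
    (h0 : D₁.pt 0 = D₂.pt 0) (h1 : D₁.pt 1 = D₂.pt 1) : P D₁ = P D₂ := by
  have h := hcov.eq_map_of_image (D := D₂) (D' := D₁) (Φ := ContinuousMap.id ℂ)
    differentiableOn_id (injOn_id _) (by simp [hc]) (by simp [h0]) (by simp [h1])
  rw [h, curveClassMap_id, Measure.map_id]

/-- Registered helper `exitRigidity_exitFunction_le_touch` (for stub `stub_exitRigidity`).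
**The touch envelope dominates the exit function.** Let `P` be chordal, conformally covariant and
target independent, `D = (Ω; a, b)` a Dobrushin domain and `R` a conformal rectangle on the same
domain with the same first two marked points (`R = (Ω; a, b, c, d)`, any boundary
parametrisation) whose third arc `(cd)` lies in the ball `B(z, ε)`. Then
`h_P(R) = P_{(Ω; a, c)}((cd) before (bc)) ≤ P_D(γ meets B(z, ε))`: by the target-independence
transfer the left side is `P_{(Ω; a, b)}((cd) before (bc))`, `P_{(Ω; a, b)} = P_D` by conformal
covariance (identity map), and `(cd) before (bc)` forces a visit to `B(z, ε)`. -/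
theorem exitRigidity_exitFunction_le_touch : ∀ P : ChordalFamily, P.IsChordal → P.IsConformallyCovariant → P.IsTargetIndependent → ∀ (D : DobrushinDomain) (R : ConformalRectangle) (z : ℂ) (ε : ℝ), R.carrier = D.carrier → R.pt 0 = D.pt 0 → R.pt 1 = D.pt 1 → R.arc 2 ⊆ Metric.ball z ε → (P (R.chord 0 2 (by decide))).real (CurveClass.hitsBefore (R.arc 2) (R.arc 1)) ≤ (P D).real {γ | ∃ w ∈ γ.range, dist w z < ε} := by
  intro P hP hcov hTI D R z ε hc h0 h1 hA
  have hPD : P (R.chord 0 1 (by decide)) = P D :=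
    eq_of_carrier_eq_of_isConformallyCovariant hcov hc h0 h1
  haveI := (hP D).1
  rw [← exitRigidity_targetTransfer_real P hTI R, hPD]
  exact measureReal_mono (hitsBefore_subset_touch hA)

/-! ### Dent rectangles: inserting two marked points on the free arc -/

/-- An interior point of the free arc `D.arc 1 = [b, a]` (from `b = pt 1` back to `a = pt 0`) is
`∂D(t)` for a parameter `t` strictly between `mark 1` and `mark 0 + 1`. -/
theorem exists_param_of_mem_arc_one (D : DobrushinDomain) {z : ℂ} (hz : z ∈ D.arc 1)
    (hz0 : z ≠ D.pt 0) (hz1 : z ≠ D.pt 1) :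
    ∃ t : ℝ, D.mark 1 < t ∧ t < D.mark 0 + 1 ∧ D.boundary t = z := by
  obtain ⟨t, ht, rfl⟩ := hz
  rw [MarkedDomain.nextMark_one_two] at ht
  refine ⟨t, lt_of_le_of_ne ht.1 ?_, lt_of_le_of_ne ht.2 ?_, rfl⟩
  · rintro rfl
    exact hz1 rfl
  · rintro h
    apply hz0
    rw [h, D.periodic_boundary]
    rfl

/-- **Dent rectangles exist.** For a Dobrushin domain `D = (Ω; a, b)` and parameters
`mark 1 < s₂ < s₃ < mark 0 + 1` (two points `c = ∂Ω(s₂)`, `d = ∂Ω(s₃)` on the free arc, in the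
boundary order `a, b, c, d`), the conformal rectangle `(Ω; a, b, c, d)` exists: same carrier,
boundary loop re-based at `a` (`t ↦ ∂Ω(t + mark 0)`, marks `0, mark 1 - mark 0, s₂ - mark 0,
s₃ - mark 0`), marked points `a, b, c, d`, arcs `(ab) = D.arc 0`, `(bc) = ∂Ω[mark 1, s₂]`,
`(cd) = ∂Ω[s₂, s₃]`, `(da) = ∂Ω[s₃, mark 0 + 1]`. -/
theorem exists_dentRectangle (D : DobrushinDomain) {s₂ s₃ : ℝ} (h₁ : D.mark 1 < s₂) (h₂ : s₂ < s₃)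
    (h₃ : s₃ < D.mark 0 + 1) :
    ∃ R : ConformalRectangle, R.carrier = D.carrier ∧
      (R.boundary = fun t => D.boundary (t + D.mark 0)) ∧
      R.mark = ![0, D.mark 1 - D.mark 0, s₂ - D.mark 0, s₃ - D.mark 0] ∧
      R.pt 0 = D.pt 0 ∧ R.pt 1 = D.pt 1 ∧ R.pt 2 = D.boundary s₂ ∧ R.pt 3 = D.boundary s₃ ∧
      R.arc 0 = D.arc 0 ∧ R.arc 1 = D.boundary '' Icc (D.mark 1) s₂ ∧
      R.arc 2 = D.boundary '' Icc s₂ s₃ ∧ R.arc 3 = D.boundary '' Icc s₃ (D.mark 0 + 1) := by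
  have hm0 := D.mark_mem 0
  have hm1 := D.mark_mem 1
  have h01 : D.mark 0 < D.mark 1 := D.mark_zero_lt_mark_one
  let J : JordanDomain :=
    { carrier := D.carrier
      boundary := fun t => D.boundary (t + D.mark 0)
      isOpen := D.isOpen
      isBounded := D.isBounded
      isConnected := D.isConnected
      continuous_boundary := D.continuous_boundary.comp (continuous_id.add continuous_const)
      periodic_boundary := fun t => by
        simp only
        rw [add_right_comm]
        exact D.periodic_boundary _
      injOn_boundary := by
        intro s hs t ht h
        have := injOn_boundary_Ico_shift D.toJordanDomain hm0.1 hm0.2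
          ⟨by linarith [hs.1], by linarith [hs.2]⟩ ⟨by linarith [ht.1], by linarith [ht.2]⟩ h
        linarith
      range_boundary := by
        rw [← D.range_boundary]
        exact (add_right_surjective (D.mark 0)).range_comp D.boundary }
  let R : ConformalRectangle :=
    { toJordanDomain := J
      mark := ![0, D.mark 1 - D.mark 0, s₂ - D.mark 0, s₃ - D.mark 0]
      strictMono_mark := by
        refine Fin.strictMono_iff_lt_succ.2 fun k => ?_
        fin_cases k <;> simp <;> linarith
      mark_mem := by
        intro k
        fin_cases k <;> simp <;> (try constructor) <;> linarith }
  have hIcc : ∀ u v : ℝ, (fun t => D.boundary (t + D.mark 0)) '' Icc u v =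
      D.boundary '' Icc (u + D.mark 0) (v + D.mark 0) := fun u v => by
    rw [← image_add_const_Icc, image_image]
  have hn0 : R.nextMark 0 = D.mark 1 - D.mark 0 := by
    rw [R.nextMark_of_lt 0 (by decide)]; rfl
  have hn1 : R.nextMark 1 = s₂ - D.mark 0 := by
    rw [R.nextMark_of_lt 1 (by decide)]; rfl
  have hn2 : R.nextMark 2 = s₃ - D.mark 0 := by
    rw [R.nextMark_of_lt 2 (by decide)]; rfl
  have hn3 : R.nextMark 3 = 0 + 1 := R.nextMark_of_not_lt 3 (by decide)
  refine ⟨R, rfl, rfl, rfl, ?_, ?_, ?_, ?_, ?_, ?_, ?_, ?_⟩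
  · show D.boundary (0 + D.mark 0) = D.boundary (D.mark 0)
    rw [zero_add]
  · show D.boundary (D.mark 1 - D.mark 0 + D.mark 0) = D.boundary (D.mark 1)
    rw [sub_add_cancel]
  · show D.boundary (s₂ - D.mark 0 + D.mark 0) = D.boundary s₂
    rw [sub_add_cancel]
  · show D.boundary (s₃ - D.mark 0 + D.mark 0) = D.boundary s₃
    rw [sub_add_cancel]
  · show (fun t => D.boundary (t + D.mark 0)) '' Icc (0 : ℝ) (R.nextMark 0) = _
    rw [hn0, hIcc, zero_add, sub_add_cancel, MarkedDomain.arc, MarkedDomain.nextMark_zero_two]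
  · show (fun t => D.boundary (t + D.mark 0)) '' Icc (D.mark 1 - D.mark 0) (R.nextMark 1) = _
    rw [hn1, hIcc, sub_add_cancel, sub_add_cancel]
  · show (fun t => D.boundary (t + D.mark 0)) '' Icc (s₂ - D.mark 0) (R.nextMark 2) = _
    rw [hn2, hIcc, sub_add_cancel, sub_add_cancel]
  · show (fun t => D.boundary (t + D.mark 0)) '' Icc (s₃ - D.mark 0) (R.nextMark 3) = _
    rw [hn3, hIcc, sub_add_cancel, zero_add, add_comm]

/-- **Small dent rectangles around an interior point of the free arc.** For `z = ∂Ω(t)` with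
`mark 1 < t < mark 0 + 1` and `ε > 0` there is a conformal rectangle `(Ω; a, b, c, d)` on `D`
with `c = ∂Ω(t - δ)`, `d = ∂Ω(t + δ)` for some `δ > 0`, whose third arc `(cd) = ∂Ω[t - δ, t + δ]`
contains `z` and lies in `B(z, ε)` (continuity of the boundary loop at `t`). -/
theorem exists_dentRectangle_subset_ball (D : DobrushinDomain) {t : ℝ} (ht₁ : D.mark 1 < t)
    (ht₂ : t < D.mark 0 + 1) {ε : ℝ} (hε : 0 < ε) :
    ∃ (R : ConformalRectangle) (δ : ℝ), 0 < δ ∧ R.carrier = D.carrier ∧ R.pt 0 = D.pt 0 ∧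
      R.pt 1 = D.pt 1 ∧ R.pt 2 = D.boundary (t - δ) ∧ R.pt 3 = D.boundary (t + δ) ∧
      R.arc 0 = D.arc 0 ∧ R.arc 1 = D.boundary '' Icc (D.mark 1) (t - δ) ∧
      R.arc 2 = D.boundary '' Icc (t - δ) (t + δ) ∧
      R.arc 3 = D.boundary '' Icc (t + δ) (D.mark 0 + 1) ∧
      D.boundary t ∈ R.arc 2 ∧ R.arc 2 ⊆ ball (D.boundary t) ε := by
  obtain ⟨δ₀, hδ₀, hball⟩ := Metric.continuous_iff.1 D.continuous_boundary t ε hε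
  set δ : ℝ := min (δ₀ / 2) (min ((t - D.mark 1) / 2) ((D.mark 0 + 1 - t) / 2)) with hδ
  have hδpos : 0 < δ := lt_min (by linarith) (lt_min (by linarith) (by linarith))
  have hδ₁ : δ ≤ δ₀ / 2 := min_le_left _ _
  have hδ₂ : δ ≤ (t - D.mark 1) / 2 := (min_le_right _ _).trans (min_le_left _ _)
  have hδ₃ : δ ≤ (D.mark 0 + 1 - t) / 2 := (min_le_right _ _).trans (min_le_right _ _)
  obtain ⟨R, hc, -, -, h0, h1, h2, h3, ha0, ha1, ha2, ha3⟩ :=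
    exists_dentRectangle D (s₂ := t - δ) (s₃ := t + δ) (by linarith) (by linarith) (by linarith)
  refine ⟨R, δ, hδpos, hc, h0, h1, h2, h3, ha0, ha1, ha2, ha3, ?_, ?_⟩
  · rw [ha2]
    exact ⟨t, ⟨by linarith, by linarith⟩, rfl⟩
  · rw [ha2]
    rintro _ ⟨s, hs, rfl⟩
    refine hball s ?_
    rw [Real.dist_eq, abs_lt]
    constructor <;> linarith [hs.1, hs.2]

/-! ### The dent inequality -/

/-- **The dent inequality** (target-independence transfer + monotone comparison, assembled). Let
`P` be chordal, conformally covariant and target independent, `D = (Ω; a, b)` a Dobrushin domain,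
`z` an interior point of its free arc `[b, a]`, and `ε > 0`. Then there is a conformal rectangle
`R = (Ω; a, b, c, d)` on `D` (same carrier, first two marked points `a, b`), non-degenerate
(`c ≠ d`), with `z ∈ (cd) ⊆ B(z, ε)`, such that
`h_P(R) = P_{(Ω; a, c)}((cd) before (bc)) ≤ P_D(γ meets B(z, ε))`.
This is the "≤" half of the dent argument of idea card `swallowing-skeleton-rs-pin` (FL4): the
touch upper envelope bounds the exit function along the dent rectangles at `z`. -/
theorem exitRigidity_touchEnvelope (P : ChordalFamily) (hP : P.IsChordal)
    (hcov : P.IsConformallyCovariant) (hTI : P.IsTargetIndependent) (D : DobrushinDomain) {z : ℂ}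
    (hz : z ∈ D.arc 1) (hz0 : z ≠ D.pt 0) (hz1 : z ≠ D.pt 1) {ε : ℝ} (hε : 0 < ε) :
    ∃ R : ConformalRectangle, R.carrier = D.carrier ∧ R.pt 0 = D.pt 0 ∧ R.pt 1 = D.pt 1 ∧
      R.pt 2 ≠ R.pt 3 ∧ z ∈ R.arc 2 ∧ R.arc 2 ⊆ ball z ε ∧
      (P (R.chord 0 2 (by decide))).real (CurveClass.hitsBefore (R.arc 2) (R.arc 1)) ≤
        (P D).real {γ | ∃ w ∈ γ.range, dist w z < ε} := by
  obtain ⟨t, ht₁, ht₂, rfl⟩ := exists_param_of_mem_arc_one D hz hz0 hz1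
  obtain ⟨R, δ, -, hc, h0, h1, -, -, -, -, -, -, hzR, hball⟩ :=
    exists_dentRectangle_subset_ball D ht₁ ht₂ hε
  exact ⟨R, hc, h0, h1, fun h => absurd (R.pt_injective h) (by decide), hzR, hball,
    exitRigidity_exitFunction_le_touch P hP hcov hTI D R _ ε hc h0 h1 hball⟩

/-- **The dent inequality for the exit function.** Under the covariance hypotheses of stub
`stub_exitRigidity` (chordal, conformally covariant, isometry covariant) plus target independence,
for every interior point `z` of the free arc of `D` and every `ε > 0` there is a non-degenerate
dent rectangle `R` on `D` at `z` of size `< ε` such that EVERY conformal rectangle `S` (on any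
domain) of the same conformal modulus as `R` has exit probability
`h_P(S) ≤ P_D(γ meets B(z, ε))` — i.e. `F_P(η(R)) ≤ P_D(U_ε(z))` for the exit function `F_P` of
`exitRigidity_exitFunctionOfModulus_isometry`. With the touch hypothesis of the stub this gives
`F_P(η(R_ε)) ≤ C ε^{1/3}` along the dent moduli `η(R_ε) → 0`. -/
theorem exitRigidity_exitFunctionOfModulus_le_touch (P : ChordalFamily) (hP : P.IsChordal)
    (hcov : P.IsConformallyCovariant) (hiso : P.IsIsometryCovariant) (hTI : P.IsTargetIndependent)
    (D : DobrushinDomain) {z : ℂ} (hz : z ∈ D.arc 1) (hz0 : z ≠ D.pt 0) (hz1 : z ≠ D.pt 1) {ε : ℝ}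
    (hε : 0 < ε) :
    ∃ R : ConformalRectangle, R.carrier = D.carrier ∧ R.pt 0 = D.pt 0 ∧ R.pt 1 = D.pt 1 ∧
      R.pt 2 ≠ R.pt 3 ∧ z ∈ R.arc 2 ∧ R.arc 2 ⊆ ball z ε ∧
      ∀ (S : ConformalRectangle) (φ : ConformalEquiv upperHalfPlaneSet R.carrier)
        (ψ : ConformalEquiv upperHalfPlaneSet S.carrier) (x y : Fin 4 → ℝ),
        R.IsUniformizing φ x → S.IsUniformizing ψ y → crossRatio x = crossRatio y →
          (P (S.chord 0 2 (by decide))).real (CurveClass.hitsBefore (S.arc 2) (S.arc 1)) ≤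
            (P D).real {γ | ∃ w ∈ γ.range, dist w z < ε} := by
  obtain ⟨R, hc, h0, h1, hne, hzR, hball, hle⟩ := exitRigidity_touchEnvelope P hP hcov hTI D hz hz0 hz1 hε
  refine ⟨R, hc, h0, h1, hne, hzR, hball, fun S φ ψ x y hφ hψ hcr => ?_⟩
  rw [← exitRigidity_exitFunctionOfModulus_isometry P hP hcov hiso R S φ ψ x y hφ hψ hcr]
  exact hle

end Summit.CriticalPhenomena.CardyFormulaZ2.Theorems.SymmetryUpgradeR.SwallowingSkeleton
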